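import Summits.KontsevichZagierPeriods.KontsevichZagierPeriods.Theses.TorsionLogs
import Literature.NumberTheory.Transcendental.KZKernelConjectureForms

/-!
# F4 ON-PATH LEMMA for the rung `NeronTorsionComplexCurve` (line `NeronTorsionComplexCurve` on crux `TorsionSectorComplete`,
# stmt-KontsevichZagierPeriods-14212; forward generator G1 `next-rung`, gen 18, seed g1-KontsevichZagierPeriods-17981)

`theorem neronTorsionComplexCurve_of_kontsevichZagierPeriods : KontsevichZagierPeriods → NeronTorsionComplexCurve` (S ⇒ rung),
sorry-free: member `false` is a THEOREM (the floor, `stub_assembly`); member `true` follows from Conjecture 1 in kernel form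
(`kzKernelConjecture_iff_isRational`) and the value hypothesis of a tied element (it evaluates to `0`).  The rung is a consequence of
S pinned at its other end to the proved floor, which discharges the [nec]-trap: a consequence of S that is NOT a consequence of the
floor (the floor never leaves real curves; kernel probe `floor → rung` open) and does NOT give S back (probe `rung → S` open).
Self-contained: verbatim copies of the two `def`s of `Lines/NeronTorsionComplexCurve.lean` in the namespace
`…NeronTorsionComplexCurve.OnPath` (the skeleton module carries the same theorem about the registered decl).
[cite: KontsevichZagier2001, §1.2 Conjecture 1]
-/

noncomputable section

-- `Summit.KontsevichZagierPeriods.KontsevichZagierPeriods.…` is the tree's mandated layout (single-conjunct summit).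
set_option linter.dupNamespace false

namespace Summit.KontsevichZagierPeriods.KontsevichZagierPeriods.Cruxes.TorsionSectorComplete.NeronTorsionComplexCurve.OnPath

open Literature.NumberTheory.Transcendental
open Summit.KontsevichZagierPeriods.KontsevichZagierPeriods.Cruxes.NeronTorsionSector.Translation (stub_assembly)

/-- Verbatim copy of `Lines/NeronTorsionComplexCurve.lean :: NeronChordMember`. -/
def NeronChordMember : Bool → Prop
  | false => ∀ (g₂ g₃ e₁ xP yP : ℝ) (N a p q : ℕ) (f : ℝ → ℝ), (∀ x, f x = 4 * x ^ 3 - g₂ * x - g₃) → g₂ ^ 3 - 27 * g₃ ^ 2 ≠ 0 → f e₁ = 0 → 0 < e₁ → (∀ x, e₁ < x → 0 < f x) → e₁ < xP → yP ^ 2 = f xP → 3 ≤ N → 0 < a → 2 * a < N → (∀ hns : (⟨0, 0, 0, -g₂ / 4, -g₃ / 4⟩ : WeierstrassCurve ℝ).toAffine.Nonsingular xP (yP / 2), addOrderOf (WeierstrassCurve.Affine.Point.some xP (yP / 2) hns) = N) → (N : ℝ) * (∫ x in Set.Ioi xP, (Real.sqrt (f x))⁻¹) = a * (2 * ∫ x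 in Set.Ioi e₁, (Real.sqrt (f x))⁻¹) → Nat.Coprime p q → (q : ℤ) * ((N : ℤ) - 2 * (a : ℤ)) = (p : ℤ) * (2 * (N : ℤ)) → ∀ (rI rP : Literature.NumberTheory.Transcendental.KZ.IntegralRep 2), rI.domain = {z | e₁ < z 1 ∧ z 1 < z 0 ∧ z 0 < xP} → Set.EqOn rI.integrand (fun z => z 1 / (Real.sqrt (f (z 1)) * Real.sqrt (f (z 0)))) rI.domain → rP.domain = {z | e₁ < z 0 ∧ e₁ < z 1} → Set.EqOn rP.integrand (fun z => (Real.sqrt (f (z 0)))⁻¹ * ((g₂ * z 1 + 2 * g₃) / (2 * (z 1) ^ 2 * Real.sqrt (f (z 1))))) rP.domain → ∃ (c : ℤ) (B : ℝ) (rB : Literature.NumberTheory.Transcendental.KZ.IntegralRep 1), 1 < B ∧ IsAlgebraic ℚ B ∧ rB.domain = {t | 1 < t 0 ∧ t 0 < B} ∧ Set.EqOn rB.integrand (fun t => (t 0)⁻¹) rB.domain ∧ ((q : ℤ) ^ 2) • Literature.NumberTheory.Transcendental.KZ.of rI + ((p : ℤ) ^ 2) • Literature.NumberTheory.Transcendental.KZ.of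 rP - c • Literature.NumberTheory.Transcendental.KZ.of rB ∈ Literature.NumberTheory.Transcendental.KZ.relations
  | true => ∀ (g₂ g₃ e e' e'' xP yP : ℂ) (yc yA yB : ℝ → ℂ) (α : ℝ) (N : ℕ) (a' b' M k m : ℤ) (f : ℂ → ℂ), (∀ x, f x = 4 * x ^ 3 - g₂ * x - g₃) → f e = 0 → f e' = 0 → f e'' = 0 → e ≠ e' → e ≠ e'' → e' ≠ e'' → ContinuousOn yc (Set.Icc 0 1) → yc 1 = yP → (∀ s ∈ Set.Icc (0 : ℝ) 1, yc s ^ 2 = f (e + (s : ℂ) * (xP - e))) → (∀ s ∈ Set.Ioc (0 : ℝ) 1, yc s ≠ 0) → ContinuousOn yA (Set.Icc 0 1) → (∀ s ∈ Set.Icc (0 : ℝ) 1, yA s ^ 2 = f (e' + (s : ℂ) * (e - e'))) → (∀ s ∈ Set.Ioo (0 : ℝ) 1, yA s ≠ 0) → ContinuousOn yB (Set.Icc 0 1) → (∀ s ∈ Set.Icc (0 : ℝ) 1, yB s ^ 2 = f (e'' + (s : ℂ) * (e - e''))) → (∀ s ∈ Set.Ioo (0 : ℝ) 1, yB s ≠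 0) → 0 < N → (2 * (N : ℂ)) * (∫ s in Set.Ioo (0 : ℝ) 1, (xP - e) / yc s) = (a' : ℂ) * (2 * ∫ s in Set.Ioo (0 : ℝ) 1, (e - e') / yA s) + (b' : ℂ) * (2 * ∫ s in Set.Ioo (0 : ℝ) 1, (e - e'') / yB s) → M = -2 * (N : ℤ) ^ 2 * k → 1 < α → ∀ (rJ rC : Literature.NumberTheory.Transcendental.KZ.IntegralRep 2) (rL : Literature.NumberTheory.Transcendental.KZ.IntegralRep 1), rJ.domain = {z | 0 < z 1 ∧ z 1 < z 0 ∧ z 0 < 1} → Set.EqOn rJ.integrand (fun z => ((xP - e) ^ 2 * (e + ((z 1 : ℝ) : ℂ) * (xP - e)) / (yc (z 1) * yc (z 0))).re) rJ.domain → rC.domain = {z | 0 < z 0 ∧ z 0 < 1 ∧ 0 < z 1 ∧ z 1 < 1} → Set.EqOn rC.integrand (fun z => (((a' : ℂ) * ((e - e') / yA (z 0)) + (b' : ℂ) * ((e - e'') / yB (z 0))) * ((a' : ℂ) * ((e' + ((z 1 : ℝ) : ℂ) * (e - e')) * (e - e') / yA (z 1)) + (b' : ℂ) * ((e'' + ((z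 1 : ℝ) : ℂ) * (e - e'')) * (e - e'') / yB (z 1)))).re) rC.domain → rL.domain = {t | 1 < t 0 ∧ t 0 < α} → Set.EqOn rL.integrand (fun t => (t 0)⁻¹) rL.domain → (M : ℝ) * rJ.value + k * rC.value = m * rL.value → M • Literature.NumberTheory.Transcendental.KZ.of rJ + k • Literature.NumberTheory.Transcendental.KZ.of rC - m • Literature.NumberTheory.Transcendental.KZ.of rL ∈ Literature.NumberTheory.Transcendental.KZ.relations

/-- Verbatim copy of `Lines/NeronTorsionComplexCurve.lean :: NeronTorsionComplexCurve` (THE RUNG). -/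
def NeronTorsionComplexCurve : Prop := ∀ nonRealCurve : Bool, NeronChordMember nonRealCurve

/-- **F4 on-path lemma, member by member:** the summit implies each member of the family. -/
@[simp] theorem neronChordMember_of_kontsevichZagierPeriods (h : _root_.KontsevichZagierPeriods) (b : Bool) :
    NeronChordMember b := by
  have hK : KZKernelConjecture := kzKernelConjecture_iff_isRational.mpr h
  cases b
  · exact (stub_assembly :
      Summit.KontsevichZagierPeriods.KontsevichZagierPeriods.Theses.TorsionLogs.NeronTorsionPrimitiveChain)
  · intro g₂ g₃ e e' e'' xP yP yc yA yB α N a' b' M k m f _ _ _ _ _ _ _ _ _ _ _ _ _ _ _ _ _ _ _ _ _ rJ rC rL _ _ _ _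
      _ _ hval
    apply hK
    rw [map_sub, map_add, map_zsmul, map_zsmul, map_zsmul, KZ.eval_of, KZ.eval_of, KZ.eval_of, zsmul_eq_mul,
      zsmul_eq_mul, zsmul_eq_mul]
    linarith [hval]

/-- **F4 ON-PATH LEMMA: the summit implies the rung.** -/
@[simp] theorem neronTorsionComplexCurve_of_kontsevichZagierPeriods (h : _root_.KontsevichZagierPeriods) :
    NeronTorsionComplexCurve := fun b => neronChordMember_of_kontsevichZagierPeriods h b

/-- The same, as an implication (the literal shape `S → Rung` of the tribunal's forward probe). -/
theorem onPath : _root_.KontsevichZagierPeriods → NeronTorsionComplexCurve :=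
  neronTorsionComplexCurve_of_kontsevichZagierPeriods

end Summit.KontsevichZagierPeriods.KontsevichZagierPeriods.Cruxes.TorsionSectorComplete.NeronTorsionComplexCurve.OnPath

end
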